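import Summits.QuantumAdvantage.QuantumAdvantage.Theorems.SymplecticPurityDeqThesisOneSidedLemmas
import Summits.QuantumAdvantage.QuantumAdvantage.Theorems.SymplecticPurityDeqThesisGoldWalsh
import Mathlib.RingTheory.Trace.Basic
import Mathlib.LinearAlgebra.BilinearForm.Properties
import Mathlib.FieldTheory.Finite.Trace

/-!
# Crux `DeqThesis` (stmt-QuantumAdvantage-0242), line `Sketch` v4 — stub `stub_goldFlat`, lemmas

Bookkeeping for the local-flatness estimate of the normalised TWO-GOLD-MAP graph state
`ĝ₂ = (√2ⁿ)⁻¹ Σ_x |x⟩|e((e⁻¹x)³)⟩|e((e⁻¹x)⁵)⟩` (on `n + (n + n)` wires) against locally rotated Pauli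
strings (file `SymplecticPurityDeqThesisGoldFlat.lean`; lead c1's reshape of the kill witness, skeleton
`Cruxes/DeqThesis/Lines/Sketch.lean` v4):

* `sum_graph_indicator₂`, `graph_dot_tensorAll_mulVec₂` — the graph-vector expansion
  `⟨g| ⊗N |g⟩ = c̄ c Σ_{x,x'} A(x,x') B(f x, f x')` for `g = c Σ_x |x⟩|f x⟩` with a value register of a
  DIFFERENT size `m` (here `m = n + n`), generalising `OneSided.graph_dot_tensorAll_mulVec`;
* `card_filter_fifth_diff_le_four`, `card_filter_fifth_xor_le_four` — the differential of `x ↦ x⁵` is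
  at most four-to-one (`(v + a)⁵ + v⁵ = b` is `a v⁴ + a⁴ v = b + a⁵`, degree `4` in `v`);
* `exists_trace_mul_eq` — every additive functional of a finite field of characteristic two is
  `z ↦ Tr(b z)` (non-degeneracy of the trace form), and `abs_sum_sign_gold_le` — the diagonal Walsh
  bound `|Σ_x (−1)^{mA·x + m₁·[x³] + m₂·[x⁵]}| ≤ 4 √2ⁿ` for masks not all zero (via
  `GoldWalsh.abs_walsh_gold_add_le`, `abs_walsh_cube_le`, `sum_sign_eq_zero`);
* `norm_double_sum_le_cs` — the pairing `x' = x ⊕ d` with CAUCHY–SCHWARZ BETWEEN TWO VALUE REGISTERS: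
  `|Σ_{x,x'} A(x,x') B₁(F₁x,F₁x') B₂(F₂x,F₂x')| ≤ D + √φ₁ √φ₂ Σ_d w_A(d)` (fibres `≤ φᵣ`, `Σ_t wᵣ(t)² ≤ 1`):
  the value-side sum costs only the fibre sizes, not `|Im D_d|^{1/2} = 2^{(n−1)/2}`.
-/

set_option linter.dupNamespace false -- D-0017: single-problem summit ⇒ `QuantumAdvantage.QuantumAdvantage` by design

namespace Summit.QuantumAdvantage.QuantumAdvantage.Theorems.SymplecticPurity

open Matrix Finset Polynomial Literature.Computability.QuantumComplexity Literature.Computability.Cryptography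

namespace GoldFlat

/-! ### Registers on `n + m` wires: graph vectors with a value register of size `m` -/

section Graph

variable {n m : ℕ}

/-- Splitting a sum over `n + m`-bit strings into the two registers. -/
theorem sum_qreg_add₂ (F : QReg (n + m) → ℂ) :
    ∑ w, F w = ∑ x : QReg n, ∑ y : QReg m, F (Fin.append x y) := by
  rw [← Fintype.sum_prod_type']
  refine (Fintype.sum_bijective (fun p : QReg n × QReg m => Fin.append p.1 p.2) ⟨?_, ?_⟩ _ _
    (fun _ => rfl)).symm
  · intro p q h
    have h1 : p.1 = q.1 := by
      funext i
      have := congrFun h (Fin.castAdd m i)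
      simpa only [Fin.append_left] using this
    have h2 : p.2 = q.2 := by
      funext j
      have := congrFun h (Fin.natAdd n j)
      simpa only [Fin.append_right] using this
    exact Prod.ext h1 h2
  · intro w
    exact ⟨(fun i => w (Fin.castAdd m i), fun j => w (Fin.natAdd n j)), Fin.append_castAdd_natAdd⟩

/-- Summing an indicator of the graph `{(x, f x)}` against `F` picks out the graph points. -/
theorem sum_graph_indicator₂ (f : QReg n → QReg m) (F : QReg (n + m) → ℂ) :
    ∑ w : QReg (n + m), (if (fun j : Fin m => w (Fin.natAdd n j)) = f (fun i : Fin n => w (Fin.castAdd m i))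
      then F w else 0) = ∑ x : QReg n, F (Fin.append x (f x)) := by
  rw [sum_qreg_add₂]
  refine Finset.sum_congr rfl fun x _ => ?_
  simp only [Fin.append_left, Fin.append_right]
  rw [Finset.sum_eq_single (f x)]
  · rw [if_pos rfl]
  · exact fun y _ hy => if_neg fun h => hy h
  · exact fun h => absurd (Finset.mem_univ _) h

/-- **Expectation of a product operator in a weighted graph vector** with a value register of size
`m`: for `g = c · Σ_x |x⟩|f x⟩` and `N = ⊗ₖ Nₖ` on `n + m` wires,
`⟨g| N |g⟩ = c̄ c Σ_{x, x'} (∏_i N_i (x_i, x'_i)) (∏_j N_{n+j} ((f x)_j, (f x')_j))`. -/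
theorem graph_dot_tensorAll_mulVec₂ (f : QReg n → QReg m)
    (N : Fin (n + m) → Matrix Bool Bool ℂ) (c : ℂ) (g : QReg (n + m) → ℂ)
    (hg : g = fun w => if (fun j : Fin m => w (Fin.natAdd n j)) = f (fun i : Fin n => w (Fin.castAdd m i))
      then c else 0) :
    star g ⬝ᵥ (tensorAll N).mulVec g =
      star c * c * ∑ x : QReg n, ∑ x' : QReg n,
        (∏ i : Fin n, N (Fin.castAdd m i) (x i) (x' i)) *
          ∏ j : Fin m, N (Fin.natAdd n j) (f x j) (f x' j) := by
  have hs : ∀ (p : Prop) [Decidable p] (X : ℂ),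
      star (if p then c else 0) * X = if p then star c * X else 0 := by
    intro p _ X; split_ifs <;> simp
  have ht : ∀ (p : Prop) [Decidable p] (X : ℂ),
      X * (if p then c else 0) = if p then X * c else 0 := by
    intro p _ X; split_ifs <;> simp
  have hin : ∀ w : QReg (n + m),
      (∑ w' : QReg (n + m), if (fun j : Fin m => w' (Fin.natAdd n j)) = f (fun i : Fin n => w' (Fin.castAdd m i))
        then tensorAll N w w' * c else 0) = ∑ x' : QReg n, tensorAll N w (Fin.append x' (f x')) * c :=
    fun w => sum_graph_indicator₂ f (fun w' => tensorAll N w w' * c)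
  subst hg
  simp only [dotProduct, Matrix.mulVec_apply_eq_sum, Pi.star_apply, hs, ht, hin]
  rw [sum_graph_indicator₂ f, Finset.mul_sum]
  refine Finset.sum_congr rfl fun x _ => ?_
  rw [Finset.mul_sum, Finset.mul_sum]
  refine Finset.sum_congr rfl fun x' _ => ?_
  rw [tensorAll_apply, Fin.prod_univ_add]
  simp only [Fin.append_left, Fin.append_right]
  ring

end Graph

/-! ### The differential of `x ↦ x⁵` is at most four-to-one -/

section Fifth

variable {K : Type*} [Field K] [Fintype K]

/-- In characteristic two, `(v + a)⁵ + v⁵ = b` has at most four solutions `v` for `a ≠ 0`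
(it reads `a v⁴ + a⁴ v + a⁵ = b`, a polynomial equation of degree `4` in `v`). -/
theorem card_filter_fifth_diff_le_four [DecidableEq K] (h2 : (2 : K) = 0) (a b : K) (ha : a ≠ 0) :
    (Finset.univ.filter fun v : K => (v + a) ^ 5 + v ^ 5 = b).card ≤ 4 := by
  set p : K[X] := C a * X ^ 4 + C (a ^ 4) * X + C (a ^ 5 - b) with hp_def
  have hp : p ≠ 0 := by
    intro h0
    have hc := congrArg (fun q : K[X] => q.coeff 4) h0
    simp only [hp_def, coeff_add, coeff_C_mul, coeff_X_pow, coeff_X, coeff_C, coeff_zero] at hc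
    norm_num at hc
    exact ha hc
  have hdeg : p.natDegree ≤ 4 := by
    rw [hp_def]
    compute_degree
  calc (Finset.univ.filter fun v : K => (v + a) ^ 5 + v ^ 5 = b).card
      ≤ p.roots.toFinset.card := by
        refine Finset.card_le_card fun v hv => ?_
        rw [Finset.mem_filter] at hv
        rw [Multiset.mem_toFinset, Polynomial.mem_roots hp, Polynomial.IsRoot.def]
        simp only [hp_def, eval_add, eval_mul, eval_C, eval_pow, eval_X]
        linear_combination hv.2 -
          (v ^ 5 + 2 * v ^ 4 * a + 5 * v ^ 3 * a ^ 2 + 5 * v ^ 2 * a ^ 3 + 2 * v * a ^ 4) * h2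
    _ ≤ Multiset.card p.roots := Multiset.toFinset_card_le _
    _ ≤ p.natDegree := Polynomial.card_roots' p
    _ ≤ 4 := hdeg

/-- **The differential of `x ↦ x⁵`, in coordinates**: for a non-zero input difference `d`, every
output difference `t` of `F = e ∘ (·)⁵ ∘ e⁻¹` is attained by at most four inputs `x`. -/
theorem card_filter_fifth_xor_le_four {n : ℕ} (hK : Fintype.card K = 2 ^ n) (e : K ≃+ (Fin n → ZMod 2))
    (F : QReg n → QReg n)
    (hF : ∀ x j, F x j = decide (e ((e.symm fun i : Fin n => if x i then 1 else 0) ^ 5) j = 1))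
    (d : QReg n) (hd : d ≠ fun _ => false) (t : QReg n) :
    (Finset.univ.filter fun x : QReg n =>
      (fun j : Fin n => Bool.xor (F x j) (F (fun i => Bool.xor (x i) (d i)) j)) = t).card ≤ 4 := by
  classical
  have h10 : (1 : ZMod 2) ≠ 0 := by decide
  set α : K := e.symm fun i : Fin n => if d i then 1 else 0 with hα
  set β : K := e.symm fun j : Fin n => if t j then 1 else 0 with hβ
  have hα0 : α ≠ 0 := by
    intro h0
    apply hd
    funext i
    have h1 := congrFun (congrArg e h0) i
    rw [hα, AddEquiv.apply_symm_apply, map_zero, Pi.zero_apply] at h1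
    cases hdi : d i
    · rfl
    · rw [hdi, if_pos rfl] at h1
      exact absurd h1 h10
  refine le_trans (Finset.card_le_card_of_injOn
    (fun x : QReg n => e.symm fun i : Fin n => if x i then 1 else 0) ?_ ?_)
    (card_filter_fifth_diff_le_four (two_eq_zero_of_card hK) α β hα0)
  · intro x hx
    rw [Finset.mem_coe, Finset.mem_filter] at hx ⊢
    refine ⟨Finset.mem_univ _, ?_⟩
    apply e.injective
    rw [map_add, hβ, AddEquiv.apply_symm_apply]
    funext j
    rw [Pi.add_apply]
    have hj := congrFun hx.2 j
    simp only [hF] at hj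
    rw [bits_xor, map_add, ← hα] at hj
    exact OneSided.xor_decide_eq_bit _ _ _ hj
  · intro x₁ _ x₂ _ h
    exact bits_injective (e.symm.injective h)

end Fifth

/-! ### Additive functionals are traces; the three-mask Walsh bound -/

section TraceRep

variable {K : Type*} [Field K] [Fintype K]

/-- **Every additive functional of a finite field of characteristic two is a trace**
`z ↦ Tr(b z)` (non-degeneracy of the trace form of the separable extension `K / 𝔽₂`). -/
theorem exists_trace_mul_eq [Algebra (ZMod 2) K] (ψ : K →+ ZMod 2) :
    ∃ b : K, ∀ z, ψ z = Algebra.trace (ZMod 2) K (b * z) := by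
  haveI : Fact (Nat.Prime 2) := ⟨Nat.prime_two⟩
  have hnd := traceForm_nondegenerate (ZMod 2) K
  refine ⟨((Algebra.traceForm (ZMod 2) K).toDual hnd).symm (ψ.toZModLinearMap 2), fun z => ?_⟩
  have h := LinearMap.BilinForm.apply_toDual_symm_apply (hB := hnd) (ψ.toZModLinearMap 2) z
  rw [Algebra.traceForm_apply] at h
  rw [h]
  rfl

/-- **The diagonal Walsh bound with three masks**: for masks `mA, m₁, m₂ : Fin n → ZMod 2`, not all
zero, `|Σ_x (−1)^{mA·x + m₁·[x³] + m₂·[x⁵]}| ≤ 4 √2ⁿ` (`[·] = e`-coordinates) — the Gold-type bound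
`abs_walsh_gold_add_le` if `m₂ ≠ 0` (after writing the coordinate functionals as traces), the cube
bound `abs_walsh_cube_le` if `m₂ = 0 ≠ m₁`, and `0` if only `mA ≠ 0`. -/
theorem abs_sum_sign_gold_le {n : ℕ} (hK : Fintype.card K = 2 ^ n) (e : K ≃+ (Fin n → ZMod 2))
    (mA m₁ m₂ : Fin n → ZMod 2) (hm : mA ≠ 0 ∨ m₁ ≠ 0 ∨ m₂ ≠ 0) :
    |∑ x : QReg n, (if (∑ i, mA i * (if x i then 1 else 0)) +
        (∑ j, m₁ j * e ((e.symm fun i : Fin n => if x i then 1 else 0) ^ 3) j) +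
        ∑ j, m₂ j * e ((e.symm fun i : Fin n => if x i then 1 else 0) ^ 5) j = 0 then (1 : ℝ) else -1)|
      ≤ 4 * Real.sqrt 2 ^ n := by
  classical
  let φ : K →+ ZMod 2 := AddMonoidHom.mk' (fun u => ∑ i : Fin n, mA i * e u i)
    (fun u v => by simp only [map_add, Pi.add_apply, mul_add, Finset.sum_add_distrib])
  let ψ₁ : K →+ ZMod 2 := AddMonoidHom.mk' (fun u => ∑ j : Fin n, m₁ j * e u j)
    (fun u v => by simp only [map_add, Pi.add_apply, mul_add, Finset.sum_add_distrib])
  let ψ₂ : K →+ ZMod 2 := AddMonoidHom.mk' (fun u => ∑ j : Fin n, m₂ j * e u j)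
    (fun u v => by simp only [map_add, Pi.add_apply, mul_add, Finset.sum_add_distrib])
  have hφ : ∀ u, φ u = ∑ i : Fin n, mA i * e u i := fun u => rfl
  have hψ₁ : ∀ u, ψ₁ u = ∑ j : Fin n, m₁ j * e u j := fun u => rfl
  have hψ₂ : ∀ u, ψ₂ u = ∑ j : Fin n, m₂ j * e u j := fun u => rfl
  have hmask : ∀ (m : Fin n → ZMod 2) (ψ : K →+ ZMod 2), (∀ u, ψ u = ∑ j : Fin n, m j * e u j) →
      ψ = 0 → m = 0 := by
    intro m ψ hψu h0
    funext j
    have h1 := DFunLike.congr_fun h0 (e.symm (Pi.single j 1))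
    rw [hψu, AddMonoidHom.zero_apply, AddEquiv.apply_symm_apply, Finset.sum_eq_single j,
      Pi.single_eq_same, mul_one] at h1
    · exact h1
    · intro j' _ hj'
      simp [hj']
    · simp
  have hbij : Function.Bijective (fun x : QReg n => e.symm fun i => if x i then (1 : ZMod 2) else 0) := by
    rw [Fintype.bijective_iff_injective_and_card]
    refine ⟨fun x y hxy => bits_injective (e.symm.injective hxy), ?_⟩
    rw [hK, Fintype.card_fun, Fintype.card_bool, Fintype.card_fin]
  rw [Fintype.sum_bijective _ hbij _ (fun u => if φ u + ψ₁ (u ^ 3) + ψ₂ (u ^ 5) = 0 then (1 : ℝ) else -1) (by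
    intro x
    simp only [hφ, hψ₁, hψ₂, AddEquiv.apply_symm_apply])]
  have hpos : (0 : ℝ) ≤ 4 * Real.sqrt 2 ^ n := by positivity
  by_cases h₂ : ψ₂ = 0
  · have hψ₂u : ∀ u : K, ψ₂ (u ^ 5) = 0 := fun u => by rw [h₂, AddMonoidHom.zero_apply]
    simp_rw [hψ₂u, add_zero]
    by_cases h₁ : ψ₁ = 0
    · have hψ₁u : ∀ u : K, ψ₁ (u ^ 3) = 0 := fun u => by rw [h₁, AddMonoidHom.zero_apply]
      simp_rw [hψ₁u, add_zero]
      have hφ0 : φ ≠ 0 := by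
        intro h0
        rcases hm with h | h | h
        · exact h (hmask mA φ hφ h0)
        · exact h (hmask m₁ ψ₁ hψ₁ h₁)
        · exact h (hmask m₂ ψ₂ hψ₂ h₂)
      rw [sum_sign_eq_zero φ hφ0, abs_zero]
      exact hpos
    · exact (abs_walsh_cube_le hK φ ψ₁ h₁).trans (by
        have : (0 : ℝ) ≤ Real.sqrt 2 ^ n := by positivity
        nlinarith)
  · -- `ψ₂ ≠ 0`: write `ψ₁ = Tr(b₁ ·)`, `ψ₂ = Tr(b₂ ·)` with `b₂ ≠ 0`, and use the Gold-type bound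
    haveI : CharP K 2 := (ringChar_eq_two_of_card hK) ▸ ringChar.charP K
    letI : Algebra (ZMod 2) K := ZMod.algebra K 2
    obtain ⟨b₁, hb₁⟩ := exists_trace_mul_eq ψ₁
    obtain ⟨b₂, hb₂⟩ := exists_trace_mul_eq ψ₂
    have hb₂0 : b₂ ≠ 0 := by
      intro h0
      apply h₂
      ext u
      rw [hb₂, h0, zero_mul, map_zero, AddMonoidHom.zero_apply]
    have hre : ∀ u : K, φ u + ψ₁ (u ^ 3) + ψ₂ (u ^ 5) =
        φ u + Algebra.trace (ZMod 2) K (b₁ * u ^ 3 + b₂ * u ^ 5) := by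
      intro u
      rw [hb₁, hb₂, map_add, add_assoc]
    simp_rw [hre]
    exact GoldWalsh.abs_walsh_gold_add_le hK hb₂0 b₁ φ

end TraceRep

/-! ### The double sum: pairing with Cauchy–Schwarz between two value registers -/

section Pairing

variable {n : ℕ}

/-- Cauchy–Schwarz for a sum of products of two non-negative families. -/
theorem sum_mul_le_sqrt_mul_sqrt {ι : Type*} (s : Finset ι) (f g : ι → ℝ) (P Q : ℝ)
    (hP : ∑ i ∈ s, f i ^ 2 ≤ P) (hQ : ∑ i ∈ s, g i ^ 2 ≤ Q) :
    ∑ i ∈ s, f i * g i ≤ Real.sqrt P * Real.sqrt Q := by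
  have hP0 : 0 ≤ P := le_trans (Finset.sum_nonneg fun i _ => sq_nonneg _) hP
  have hCS := Finset.sum_mul_sq_le_sq_mul_sq s f g
  have h2 : (∑ i ∈ s, f i * g i) ^ 2 ≤ P * Q :=
    hCS.trans (mul_le_mul hP hQ (Finset.sum_nonneg fun i _ => sq_nonneg _) hP0)
  calc ∑ i ∈ s, f i * g i ≤ |∑ i ∈ s, f i * g i| := le_abs_self _
    _ ≤ Real.sqrt (P * Q) := Real.abs_le_sqrt h2
    _ = Real.sqrt P * Real.sqrt Q := Real.sqrt_mul hP0 Q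

/-- A weight with `Σ_t w(t)² ≤ 1`, composed with a map all of whose fibres have size `≤ φ`, has
`Σ_x w(G x)² ≤ φ`. -/
theorem sum_sq_comp_le_of_fibre {α β : Type*} [Fintype α] [Fintype β] [DecidableEq β]
    (w : β → ℝ) (G : α → β) (φ : ℕ) (hw : ∑ t, w t ^ 2 ≤ 1)
    (hfib : ∀ t, (Finset.univ.filter fun x => G x = t).card ≤ φ) :
    ∑ x, w (G x) ^ 2 ≤ φ := by
  rw [← Finset.sum_fiberwise' Finset.univ G (fun t => w t ^ 2)]
  calc ∑ t, ∑ x ∈ Finset.univ.filter (fun x => G x = t), w t ^ 2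
      = ∑ t, ((Finset.univ.filter fun x => G x = t).card : ℝ) * w t ^ 2 := by
        refine Finset.sum_congr rfl fun t _ => ?_
        rw [Finset.sum_const, nsmul_eq_mul]
    _ ≤ ∑ t, (φ : ℝ) * w t ^ 2 :=
        Finset.sum_le_sum fun t _ => mul_le_mul_of_nonneg_right (by exact_mod_cast hfib t) (sq_nonneg _)
    _ = φ * ∑ t, w t ^ 2 := (Finset.mul_sum _ _ _).symm
    _ ≤ φ * 1 := mul_le_mul_of_nonneg_left hw (Nat.cast_nonneg _)
    _ = φ := mul_one _

/-- **Pairing by the input difference, with Cauchy–Schwarz between two value registers.** For a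
kernel `A` on the input register dominated by a product weight of the difference pattern, kernels
`B₁, B₂` on two value registers dominated by weights `w₁, w₂` with `Σ_t wᵣ(t)² ≤ 1`, and maps
`F₁, F₂` whose non-trivial differentials are at most `φ₁`-, `φ₂`-to-one,
`|Σ_{x,x'} A(x,x') B₁(F₁x,F₁x') B₂(F₂x,F₂x')| ≤ D + √φ₁ √φ₂ Σ_d w_A(d)` where `D` bounds the diagonal. -/
theorem norm_double_sum_le_cs (A B₁ B₂ : QReg n → QReg n → ℂ) (F₁ F₂ : QReg n → QReg n)
    (wA w₁ w₂ : QReg n → ℝ) (D : ℝ) (φ₁ φ₂ : ℕ)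
    (hA : ∀ x x', ‖A x x'‖ ≤ wA (fun i => Bool.xor (x i) (x' i)))
    (hB₁ : ∀ y y', ‖B₁ y y'‖ ≤ w₁ (fun j => Bool.xor (y j) (y' j)))
    (hB₂ : ∀ y y', ‖B₂ y y'‖ ≤ w₂ (fun j => Bool.xor (y j) (y' j)))
    (hwA : ∀ d, 0 ≤ wA d) (hw₁ : ∀ t, 0 ≤ w₁ t)
    (hw₁sq : ∑ t, w₁ t ^ 2 ≤ 1) (hw₂sq : ∑ t, w₂ t ^ 2 ≤ 1)
    (hdiag : ‖∑ x, A x x * (B₁ (F₁ x) (F₁ x) * B₂ (F₂ x) (F₂ x))‖ ≤ D)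
    (hfib₁ : ∀ d : QReg n, d ≠ (fun _ => false) → ∀ t : QReg n,
      (Finset.univ.filter fun x : QReg n =>
        (fun j : Fin n => Bool.xor (F₁ x j) (F₁ (fun i => Bool.xor (x i) (d i)) j)) = t).card ≤ φ₁)
    (hfib₂ : ∀ d : QReg n, d ≠ (fun _ => false) → ∀ t : QReg n,
      (Finset.univ.filter fun x : QReg n =>
        (fun j : Fin n => Bool.xor (F₂ x j) (F₂ (fun i => Bool.xor (x i) (d i)) j)) = t).card ≤ φ₂) :
    ‖∑ x, ∑ x', A x x' * (B₁ (F₁ x) (F₁ x') * B₂ (F₂ x) (F₂ x'))‖ ≤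
      D + Real.sqrt φ₁ * Real.sqrt φ₂ * ∑ d, wA d := by
  classical
  have hC0 : 0 ≤ Real.sqrt φ₁ * Real.sqrt φ₂ := by positivity
  have hinv : ∀ x : QReg n, Function.Involutive (fun d : QReg n => fun i => Bool.xor (x i) (d i)) := by
    intro x d
    funext i
    exact OneSided.xor_xor_cancel _ _
  have hre : ∀ (x : QReg n) (f : QReg n → ℂ), ∑ x', f x' = ∑ d : QReg n, f (fun i => Bool.xor (x i) (d i)) :=
    fun x f => (Equiv.sum_comp (Function.Involutive.toPerm _ (hinv x)) f).symm
  have hT : ∑ x, ∑ x', A x x' * (B₁ (F₁ x) (F₁ x') * B₂ (F₂ x) (F₂ x')) =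
      ∑ d : QReg n, ∑ x, A x (fun i => Bool.xor (x i) (d i)) *
        (B₁ (F₁ x) (F₁ (fun i => Bool.xor (x i) (d i))) * B₂ (F₂ x) (F₂ (fun i => Bool.xor (x i) (d i)))) := by
    exact (Finset.sum_congr rfl fun x _ => hre x _).trans Finset.sum_comm
  have hO : ∀ d : QReg n, d ≠ (fun _ => false) →
      ‖∑ x, A x (fun i => Bool.xor (x i) (d i)) *
        (B₁ (F₁ x) (F₁ (fun i => Bool.xor (x i) (d i))) * B₂ (F₂ x) (F₂ (fun i => Bool.xor (x i) (d i))))‖ ≤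
        wA d * (Real.sqrt φ₁ * Real.sqrt φ₂) := by
    intro d hd
    set G₁ : QReg n → QReg n := fun x j => Bool.xor (F₁ x j) (F₁ (fun i => Bool.xor (x i) (d i)) j) with hG₁
    set G₂ : QReg n → QReg n := fun x j => Bool.xor (F₂ x j) (F₂ (fun i => Bool.xor (x i) (d i)) j) with hG₂
    have hS₁ : ∑ x, w₁ (G₁ x) ^ 2 ≤ φ₁ := sum_sq_comp_le_of_fibre w₁ G₁ φ₁ hw₁sq (hfib₁ d hd)
    have hS₂ : ∑ x, w₂ (G₂ x) ^ 2 ≤ φ₂ := sum_sq_comp_le_of_fibre w₂ G₂ φ₂ hw₂sq (hfib₂ d hd)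
    have hCS : ∑ x, w₁ (G₁ x) * w₂ (G₂ x) ≤ Real.sqrt φ₁ * Real.sqrt φ₂ :=
      sum_mul_le_sqrt_mul_sqrt _ _ _ _ _ hS₁ hS₂
    calc ‖∑ x, A x (fun i => Bool.xor (x i) (d i)) *
          (B₁ (F₁ x) (F₁ (fun i => Bool.xor (x i) (d i))) * B₂ (F₂ x) (F₂ (fun i => Bool.xor (x i) (d i))))‖
        ≤ ∑ x, ‖A x (fun i => Bool.xor (x i) (d i)) *
          (B₁ (F₁ x) (F₁ (fun i => Bool.xor (x i) (d i))) * B₂ (F₂ x) (F₂ (fun i => Bool.xor (x i) (d i))))‖ :=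
          norm_sum_le _ _
      _ ≤ ∑ x, wA d * (w₁ (G₁ x) * w₂ (G₂ x)) := by
          refine Finset.sum_le_sum fun x _ => ?_
          rw [norm_mul, norm_mul]
          have hAx := hA x (fun i => Bool.xor (x i) (d i))
          simp only [OneSided.xor_xor_cancel] at hAx
          exact mul_le_mul hAx (mul_le_mul (hB₁ _ _) (hB₂ _ _) (norm_nonneg _) (hw₁ _))
            (mul_nonneg (norm_nonneg _) (norm_nonneg _)) (hwA d)
      _ = wA d * ∑ x, w₁ (G₁ x) * w₂ (G₂ x) := by rw [Finset.mul_sum]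
      _ ≤ wA d * (Real.sqrt φ₁ * Real.sqrt φ₂) := mul_le_mul_of_nonneg_left hCS (hwA d)
  rw [hT, Fintype.sum_eq_add_sum_compl (fun _ : Fin n => false)]
  simp only [Bool.xor_false]
  calc ‖∑ x, A x x * (B₁ (F₁ x) (F₁ x) * B₂ (F₂ x) (F₂ x)) +
        ∑ d ∈ {(fun _ : Fin n => false)}ᶜ, ∑ x, A x (fun i => Bool.xor (x i) (d i)) *
          (B₁ (F₁ x) (F₁ (fun i => Bool.xor (x i) (d i))) * B₂ (F₂ x) (F₂ (fun i => Bool.xor (x i) (d i))))‖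
      ≤ ‖∑ x, A x x * (B₁ (F₁ x) (F₁ x) * B₂ (F₂ x) (F₂ x))‖ +
        ‖∑ d ∈ {(fun _ : Fin n => false)}ᶜ, ∑ x, A x (fun i => Bool.xor (x i) (d i)) *
          (B₁ (F₁ x) (F₁ (fun i => Bool.xor (x i) (d i))) * B₂ (F₂ x) (F₂ (fun i => Bool.xor (x i) (d i))))‖ :=
        norm_add_le _ _
    _ ≤ D + ∑ d ∈ {(fun _ : Fin n => false)}ᶜ, wA d * (Real.sqrt φ₁ * Real.sqrt φ₂) := by
        refine add_le_add hdiag ((norm_sum_le _ _).trans (Finset.sum_le_sum fun d hd => hO d ?_))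
        simpa using hd
    _ ≤ D + ∑ d, wA d * (Real.sqrt φ₁ * Real.sqrt φ₂) := by
        have hnn : ∀ d : QReg n, 0 ≤ wA d * (Real.sqrt φ₁ * Real.sqrt φ₂) := fun d => mul_nonneg (hwA d) hC0
        exact add_le_add le_rfl (Finset.sum_le_univ_sum_of_nonneg hnn)
    _ = D + Real.sqrt φ₁ * Real.sqrt φ₂ * ∑ d, wA d := by
        rw [← Finset.sum_mul]
        ring

end Pairing

end GoldFlat

/-- **Registered sub-goal `stub_goldFifthDiff`** (file 1/2 of stub `stub_goldFlat`, line `Sketch` v4):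
the differential of `x ↦ x⁵` is at most four-to-one in characteristic two
(`GoldFlat.card_filter_fifth_diff_le_four`); the file also carries the graph-vector expansion with a
value register of size `m`, the trace representation of additive functionals, the three-mask diagonal
Walsh bound and the Cauchy–Schwarz pairing lemma consumed by `stub_goldFlat`. -/
theorem stub_goldFifthDiff : ∀ {K : Type} [Field K] [Fintype K] [DecidableEq K], (2 : K) = 0 → ∀ (a b : K), a ≠ 0 → (Finset.univ.filter fun v : K => (v + a) ^ 5 + v ^ 5 = b).card ≤ 4 :=
  fun h2 a b ha => GoldFlat.card_filter_fifth_diff_le_four h2 a b ha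

end Summit.QuantumAdvantage.QuantumAdvantage.Theorems.SymplecticPurity
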